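import Literature.Analysis.FluidPDE.KatoLaiEvaluation
import Literature.Analysis.FluidPDE.KatoLaiCellRestriction
import HarnessLib

/-!
# Kato–Lai in the periodic cylinder: the physical velocity of a coefficient path

Analysis/FluidPDE support file for the energy-method construction of Euler flows in the
periodic cylinder (`Literature.Analysis.FluidPDE.KatoLai1984_periodicCylinderUniformExistence`;
Kato–Lai 1984, Thm I and §5–§6). The level-`s` construction (`KatoLaiLevelPath`,
`KatoLaiTimeRegularity`) produces a coefficient path `G : ℝ → X`, `X = SymL2 (Fin 3)`; this file
reads it as a physical velocity field on `ℝ³` and transfers the abstract results: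

* `AtLevel.norm_physVel_sub_l2Field_le` — the truncations `l2Field N g` converge to the physical
  field `physVel g` **uniformly** (tail of the absolutely convergent Fourier series), whence
  `AtLevel.cellRestrict_eq_toCell`: **the cell restriction `R g ∈ L²(cell)` is the class of the
  continuous function `fromTorus L (physVel g)`**, and two families with level readings and equal
  cell restrictions have physical fields **equal on the closed cylinder**
  (`AtLevel.eqOn_fromTorus_physVel`);
* `evalCLM L m x : X →L[ℝ] ℝ³`, `F ↦ (⟪E_{m,i}(x), F⟫)ᵢ` — point evaluation of the physical field
  through the level-`m` reading (`AtLevel.evalCLM_eq`);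
* `pathVel L G t x = physVel (G t) (ξ(x))` — **the velocity of a path**; along a windowed path
  (`IsWindowed`): coordinates as pairings (`IsWindowed.pathVel_apply`), **joint `C^n` regularity on
  `[0, T] × ℝ³`** for `2n + 4 ≤ p`, `p + n < s` (`IsWindowed.contDiffOn_pathVel`), and **the time
  derivative** `∂ₜ pathVel = −fromTorus (physVel (pathAcc G t))` within `[0, T]`
  (`IsWindowed.hasDerivWithinAt_pathVel`), where `pathAcc G t ∈ X` is the `L²`-level element read
  at level `4` by `𝔅̃₄(F₅, F₅)`; on a window it is `𝒜̂ f` (`pathAcc_eq_klOpExt`).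

Everything is proved; no named fact and no `sorry` is introduced.

## References

* T. Kato, C. Y. Lai, J. Funct. Anal. 56 (1984) 15–28, Thm I, §5. [KatoLai1984]
* L. Grafakos, *Classical Fourier Analysis*, 3rd ed., §3.3.3. [Grafakos2014]
-/

noncomputable section

open MeasureTheory Set Function Filter Topology TopologicalSpace
open scoped NNReal ENNReal InnerProductSpace RealInnerProductSpace ContDiff

namespace Literature.Analysis.FluidPDE

open FunctionSpaces FunctionSpaces.Torus UnitAddTorus

/-- Local notation for physical space `ℝ³ = EuclideanSpace ℝ (Fin 3)`. -/
local notation "ℝ³" => EuclideanSpace ℝ (Fin 3)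

/-- Local notation for the closed cylinder `{r ≤ 1}`. -/
local notation "𝕂" => closure (SetLike.coe unitCylinder : Set (EuclideanSpace ℝ (Fin 3)))

namespace PeriodicCylinder

variable {L : ℝ}

/-! ### Uniform convergence of the truncations to the physical field -/

section Trunc

variable {m : ℕ}

/-- The truncation as a finite sum: `l2Field N g ξ = ∑_{k ∈ ball N} Re(e_k(ξ) g k)`. [folklore] -/
theorem l2Field_apply_eq_sum (N : ℕ) (g : SymL2 (Fin 3)) (ξ : UnitAddTorus (Fin 3)) :
    l2Field N g ξ = ∑ k ∈ freqBall N, EuclideanSpace.realPart (mFourier k ξ • g k) :=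
  realTrigPoly_apply_eq_sum _ _ _

/-- The real series of the physical field converges. [folklore] -/
theorem AtLevel.hasSum_realPart (hm : 2 ≤ m) {g F : SymL2 (Fin 3)} (h : AtLevel m g F) (ξ : UnitAddTorus (Fin 3)) :
    HasSum (fun k => EuclideanSpace.realPart (mFourier k ξ • g k)) (physVel g ξ) := by
  have hs1 : Summable fun k => mFourier k ξ • g k :=
    .of_norm ((h.summable_norm hm).congr fun k => by rw [norm_smul, norm_mFourier_apply, one_mul])
  exact hs1.hasSum.mapL EuclideanSpace.realPart

/-- **Uniform truncation error**: `‖physVel g ξ − l2Field N g ξ‖ ≤ ∑_{k ∉ ball N} ‖g k‖` for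
every `ξ`. [cite: Grafakos2014, §3.3.3] -/
theorem AtLevel.norm_physVel_sub_l2Field_le (hm : 2 ≤ m) {g F : SymL2 (Fin 3)} (h : AtLevel m g F) (N : ℕ)
    (ξ : UnitAddTorus (Fin 3)) :
    ‖physVel g ξ - l2Field N g ξ‖ ≤ ∑' k : {k // k ∉ freqBall (d := Fin 3) N}, ‖g k‖ := by
  have hR := h.hasSum_realPart hm ξ
  have hsplit := hR.summable.sum_add_tsum_compl (s := freqBall N)
  rw [hR.tsum_eq] at hsplit
  have hdiff : physVel g ξ - l2Field N g ξ =
      ∑' k : ↥((freqBall N : Finset (Fin 3 → ℤ)) : Set (Fin 3 → ℤ))ᶜ, EuclideanSpace.realPart (mFourier k ξ • g k) := by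
    rw [l2Field_apply_eq_sum, ← hsplit, add_sub_cancel_left]
  rw [hdiff]
  have hns : Summable fun k : ↥((freqBall N : Finset (Fin 3 → ℤ)) : Set (Fin 3 → ℤ))ᶜ => ‖g k‖ :=
    (h.summable_norm hm).subtype _
  have hns' : Summable fun k : ↥((freqBall N : Finset (Fin 3 → ℤ)) : Set (Fin 3 → ℤ))ᶜ =>
      ‖EuclideanSpace.realPart (mFourier k ξ • g k)‖ :=
    Summable.of_nonneg_of_le (fun k => norm_nonneg _) (fun k => norm_realPart_mFourier_smul_le _ _ _) hns
  exact (norm_tsum_le_tsum_norm hns').trans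
    (Summable.tsum_le_tsum (fun k => norm_realPart_mFourier_smul_le _ _ _) hns' hns)

/-- The tails `∑_{k ∉ ball N} ‖g k‖` vanish as `N → ∞`. [folklore] -/
theorem tendsto_tail_norm (g : SymL2 (Fin 3)) :
    Tendsto (fun N : ℕ => ∑' k : {k // k ∉ freqBall (d := Fin 3) N}, ‖g k‖) atTop (𝓝 0) :=
  (tendsto_tsum_compl_atTop_zero fun k => ‖g k‖).comp tendsto_freqBall_atTop

end Trunc

/-! ### The cell restriction is the class of the physical field -/

section Restrict

variable {m : ℕ}

/-- Pull-backs of continuous torus functions are continuous. [folklore] -/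
theorem continuous_fromTorus_of_continuous {F : Type*} [NormedAddCommGroup F] [NormedSpace ℝ F] (L : ℝ)
    {V : UnitAddTorus (Fin 3) → F} (hV : Continuous V) : Continuous (fromTorus L V) :=
  (continuous_lift_iff.2 hV).comp (contDiff_boxInv L (n := 0)).continuous

/-- The physical field of a family with a level-`m ≥ 2` reading pulls back to a continuous field. [folklore] -/
theorem AtLevel.continuous_fromTorus_physVel (hm : 2 ≤ m) {g F : SymL2 (Fin 3)} (h : AtLevel m g F) (L : ℝ) :
    Continuous (fromTorus L (physVel g)) :=
  continuous_fromTorus_of_continuous L (h.continuous_physVel hm)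

/-- **The cell restriction is the class of the physical field**: `R g = [fromTorus L (physVel g)]`
in `L²(cell)` for `g` with a level-`m ≥ 2` reading. [cite: KatoLai1984, §7 (7.1)] -/
theorem AtLevel.cellRestrict_eq_toCell (hL : 0 < L) (hm : 2 ≤ m) {g F : SymL2 (Fin 3)} (h : AtLevel m g F) :
    cellRestrict hL g = toCell L (fromTorus L (physVel g)) := by
  rw [cellRestrict_apply]
  refine tendsto_nhds_unique (tendsto_cellOf_l2Field hL g) ?_
  have hc : Continuous (fromTorus L (physVel g)) := h.continuous_fromTorus_physVel hm L
  have hcN : ∀ N, Continuous (fromTorus L (l2Field N g)) := fun N => (contDiff_fromTorus L (isSmooth_l2Field N g)).continuous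
  set τ : ℕ → ℝ := fun N => ∑' k : {k // k ∉ freqBall (d := Fin 3) N}, ‖g k‖ with hτ
  have hτ0 : ∀ N, 0 ≤ τ N := fun N => tsum_nonneg fun _ => norm_nonneg _
  have hb : ∀ N, ‖cellOf L (l2Field N g) - toCell L (fromTorus L (physVel g))‖ ≤ τ N * cellL2 L (fun _ : ℝ³ => (1 : ℝ)) := by
    intro N
    have hmN := memLp_two_cylinderCell_of_continuousOn L (hcN N).continuousOn
    have hm0 := memLp_two_cylinderCell_of_continuousOn L hc.continuousOn
    rw [cellOf, ← toCell_sub hmN hm0,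
      norm_toCell_eq_cellL2 (f := fun x => fromTorus L (l2Field N g) x - fromTorus L (physVel g) x) ((hcN N).sub hc).continuousOn]
    have h1 : cellL2 L (fun x => fromTorus L (l2Field N g) x - fromTorus L (physVel g) x) ≤ cellL2 L (fun _ : ℝ³ => τ N) :=
      cellL2_mono L continuousOn_const fun x _ => by
        rw [Real.norm_of_nonneg (hτ0 N), fromTorus_eq_torusPt, fromTorus_eq_torusPt, norm_sub_rev]
        exact h.norm_physVel_sub_l2Field_le hm N _
    have h2 : cellL2 L (fun _ : ℝ³ => τ N) = |τ N| * cellL2 L (fun _ : ℝ³ => (1 : ℝ)) := by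
      rw [← cellL2_const_smul]; simp
    rw [h2, abs_of_nonneg (hτ0 N)] at h1
    exact h1
  rw [tendsto_iff_norm_sub_tendsto_zero]
  refine squeeze_zero (fun N => norm_nonneg _) hb ?_
  simpa using (tendsto_tail_norm g).mul_const (cellL2 L (fun _ : ℝ³ => (1 : ℝ)))

/-- **Functions continuous on the closed cylinder and periodic, with the same cell class, agree on
the whole closed cylinder** (`eqOn_cylinderCell_of_toCell_eq` of `KatoLaiTorusOperatorLipschitz`
plus `eqOn_closure_of_eqOn_cell`). [folklore] -/
theorem eqOn_closure_of_toCell_eq {F : Type*} [NormedAddCommGroup F] [NormedSpace ℝ F] (hL : 0 < L) {f g : ℝ³ → F}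
    (hf : ContinuousOn f 𝕂) (hg : ContinuousOn g 𝕂) (hfp : IsAxiallyPeriodic L f) (hgp : IsAxiallyPeriodic L g)
    (h : toCell L f = toCell L g) : EqOn f g 𝕂 :=
  eqOn_closure_of_eqOn_cell hL hf hg hfp hgp (eqOn_cylinderCell_of_toCell_eq hf hg h)

/-- **Equal cell restrictions force equal physical fields on the closed cylinder** (for families
with level-`m ≥ 2` readings). [folklore] -/
theorem AtLevel.eqOn_fromTorus_physVel (hL : 0 < L) (hm : 2 ≤ m) {g g' F F' : SymL2 (Fin 3)} (h : AtLevel m g F)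
    (h' : AtLevel m g' F') (hR : cellRestrict hL g = cellRestrict hL g') :
    EqOn (fromTorus L (physVel g)) (fromTorus L (physVel g')) 𝕂 := by
  rw [h.cellRestrict_eq_toCell hL hm, h'.cellRestrict_eq_toCell hL hm] at hR
  exact eqOn_closure_of_toCell_eq hL (h.continuous_fromTorus_physVel hm L).continuousOn
    (h'.continuous_fromTorus_physVel hm L).continuousOn (isAxiallyPeriodic_fromTorus hL.ne' _)
    (isAxiallyPeriodic_fromTorus hL.ne' _) hR

end Restrict

/-! ### Point evaluation as an operator -/

section EvalCLM

variable (L : ℝ) (m : ℕ)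

/-- **The evaluation operator** `X →L[ℝ] ℝ³`, `F ↦ (⟪E_{m,i}(x), F⟫)ᵢ`. [folklore] -/
def evalCLM (x : ℝ³) : SymL2 (Fin 3) →L[ℝ] ℝ³ :=
  ∑ i : Fin 3, (innerSL ℝ (evalElem L m i x)).smulRight (EuclideanSpace.single i (1 : ℝ))

/-- Coordinates of the evaluation operator. [folklore] -/
theorem evalCLM_apply (x : ℝ³) (F : SymL2 (Fin 3)) (i : Fin 3) : evalCLM L m x F i = ⟪evalElem L m i x, F⟫_ℝ := by
  rw [evalCLM, FunLike.coe_sum, Finset.sum_apply]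
  simp only [ContinuousLinearMap.smulRight_apply, innerSL_apply_apply]
  rw [WithLp.ofLp_sum, Finset.sum_apply, Finset.sum_eq_single i]
  · simp
  · intro j _ hj; simp [hj]
  · simp

variable {L m}

/-- **The evaluation operator evaluates the physical field**: `evalCLM L m x F = physVel g (ξ(x))`
when `F` is `g` at level `m ≥ 4`. [cite: Grafakos2014, Prop. 3.3.12] -/
theorem AtLevel.evalCLM_eq (hm : 4 ≤ m) {g F : SymL2 (Fin 3)} (h : AtLevel m g F) (x : ℝ³) :
    evalCLM L m x F = physVel g (torusPt L x) := by
  ext i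
  rw [evalCLM_apply, real_inner_comm, h.inner_evalElem L hm]

end EvalCLM

/-! ### The velocity of a coefficient path -/

section Path

/-- **The physical velocity of a coefficient path**: `u(t, x) = physVel (G t) (ξ(x))`. [folklore] -/
def pathVel (L : ℝ) (G : ℝ → SymL2 (Fin 3)) (t : ℝ) (x : ℝ³) : ℝ³ := fromTorus L (physVel (G t)) x

/-- Unfolding. [folklore] -/
theorem pathVel_apply (L : ℝ) (G : ℝ → SymL2 (Fin 3)) (t : ℝ) (x : ℝ³) : pathVel L G t x = physVel (G t) (torusPt L x) := rfl

/-- The velocity of a path is `L`-periodic. [folklore] -/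
theorem isAxiallyPeriodic_pathVel (hL : L ≠ 0) (G : ℝ → SymL2 (Fin 3)) (t : ℝ) : IsAxiallyPeriodic L (pathVel L G t) :=
  isAxiallyPeriodic_fromTorus hL _

/-- At a time where the path is `toL2 U`, the velocity is `fromTorus L U`. [folklore] -/
theorem pathVel_eq_of_eq_toL2 {G : ℝ → SymL2 (Fin 3)} {U : UnitAddTorus (Fin 3) → ℝ³} (hU : IsSmooth U) {t : ℝ}
    (h : G t = toL2 hU) : pathVel L G t = fromTorus L U := by
  funext x; rw [pathVel, h, physVel_toL2]

/-- `drop m F` is read at level `m` by `F`. [folklore] -/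
theorem atLevel_drop (m : ℕ) (F : SymL2 (Fin 3)) : AtLevel m (drop m F) F := fun k => by
  rw [drop_apply, smul_smul]
  have hw : ((wt m k : ℝ) : ℂ) ≠ 0 := by exact_mod_cast (wt_pos m k).ne'
  rw [mul_inv_cancel₀ hw, one_smul]

variable (hL : 0 < L)

/-- **The `L²`-level acceleration of a path**: the element read at level `4` by `𝔅̃₄(F₅, F₅)`,
`F₅ = levRead 5 (G t)`. [cite: KatoLai1984, §5 (5.6)] -/
def pathAcc (G : ℝ → SymL2 (Fin 3)) (t : ℝ) : SymL2 (Fin 3) :=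
  drop 4 (bilExt hL (show 2 ≤ 4 by norm_num) (levRead 5 (G t)) (levRead 5 (G t)))

/-- `pathAcc G t` is read at level `4` by `𝔅̃₄(F₅, F₅)`. [folklore] -/
theorem atLevel_pathAcc (G : ℝ → SymL2 (Fin 3)) (t : ℝ) :
    AtLevel 4 (pathAcc hL G t) (bilExt hL (show 2 ≤ 4 by norm_num) (levRead 5 (G t)) (levRead 5 (G t))) :=
  atLevel_drop 4 _

/-- **On a window the acceleration is `𝒜̂ f`**: if `G t = i f` at level `s ≥ 5` then
`pathAcc G t = klOpExt f`. [cite: KatoLai1984, §5 (5.6)] -/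
theorem pathAcc_eq_klOpExt {G : ℝ → SymL2 (Fin 3)} {s : ℕ} (hs : 5 ≤ s) {ε : ℝ} (hε : ε ≠ 0) {f : SymL2 (Fin 3)} {t : ℝ}
    (hGt : G t = embed s ε f) : pathAcc hL G t = klOpExt hL s ε f := by
  have hs1 : 1 ≤ s := by omega
  have h5 : levRead 5 (G t) = levelOf s hε hs hs1 f := by rw [hGt]; exact (atLevel_embed_levelOf s hε hs hs1 f).levRead_eq
  have hA := atLevel_klOpExt_bilExt hL (show 2 ≤ 4 by norm_num) hε hs hs1 f
  rw [← h5] at hA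
  exact (atLevel_pathAcc hL G t).eq_of_eq hA

variable {hL} {s : ℕ} {δ T : ℝ} {G : ℝ → SymL2 (Fin 3)} (hW : IsWindowed hL s δ T G)
include hW

/-- Along a windowed path every `G t`, `t ∈ [0, T]`, has its level-`p` reading (`p ≤ s`). [folklore] -/
theorem IsWindowed.atLevel_levRead (hs1 : 1 ≤ s) {p : ℕ} (hp : p ≤ s) {t : ℝ} (ht : t ∈ Icc 0 T) :
    AtLevel p (G t) (levRead p (G t)) := by
  obtain ⟨ε, tw, φ, u, hε, -, h1, h2, hG⟩ := hW.exists_window ht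
  have htw : t - tw ∈ Icc 0 δ := ⟨by linarith, by linarith⟩
  rw [IsWindowed.levRead_eq_levelOf hp hs1 hε hG htw]
  have hGt : G t = embed s ε (u (t - tw)) := by
    have := hG (t - tw) htw; rwa [show tw + (t - tw) = t by ring] at this
  rw [hGt]
  exact atLevel_embed_levelOf s hε hp hs1 _

/-- The windows represent `G t` at level `s` with `ε ≠ 0`. [folklore] -/
theorem IsWindowed.exists_rep {t : ℝ} (ht : t ∈ Icc 0 T) : ∃ (ε : ℝ) (f : SymL2 (Fin 3)), ε ≠ 0 ∧ G t = embed s ε f := by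
  obtain ⟨ε, tw, φ, u, hε, -, h1, h2, hG⟩ := hW.exists_window ht
  refine ⟨ε, u (t - tw), hε, ?_⟩
  have := hG (t - tw) ⟨by linarith, by linarith⟩
  rwa [show tw + (t - tw) = t by ring] at this

/-- **Coordinates of the velocity as pairings**: `u(t, x)ᵢ = ⟪levRead p (G t), E_{p,i}(x)⟫` for
`4 ≤ p ≤ s`, `t ∈ [0, T]`. [cite: Grafakos2014, Prop. 3.3.12] -/
theorem IsWindowed.pathVel_apply (hs1 : 1 ≤ s) {p : ℕ} (hp4 : 4 ≤ p) (hps : p ≤ s) {t : ℝ} (ht : t ∈ Icc 0 T) (x : ℝ³)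
    (i : Fin 3) : pathVel L G t x i = ⟪levRead p (G t), evalElem L p i x⟫_ℝ := by
  rw [(hW.atLevel_levRead hs1 hps ht).inner_evalElem L hp4]; rfl

/-- The velocity through the evaluation operator. [folklore] -/
theorem IsWindowed.pathVel_eq_evalCLM (hs1 : 1 ≤ s) {p : ℕ} (hp4 : 4 ≤ p) (hps : p ≤ s) {t : ℝ} (ht : t ∈ Icc 0 T) (x : ℝ³) :
    pathVel L G t x = evalCLM L p x (levRead p (G t)) := by
  rw [(hW.atLevel_levRead hs1 hps ht).evalCLM_eq hp4]; rfl

/-- **Joint `C^n` regularity of the velocity on `[0, T] × ℝ³`** for `2n + 4 ≤ p` and `p + n < s`.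
[cite: KatoLai1984, Thm I] -/
theorem IsWindowed.contDiffOn_pathVel {n p : ℕ} (hnp : 2 * n + 4 ≤ p) (hps : p + n < s) :
    ContDiffOn ℝ n (uncurry (pathVel L G)) (Icc 0 T ×ˢ (univ : Set ℝ³)) := by
  have hs1 : 1 ≤ s := by omega
  have hp2 : 2 ≤ p := by omega
  have hF : ContDiffOn ℝ n (fun τ => levRead p (G τ)) (Icc 0 T) := hW.contDiffOn_levRead n hp2 hps
  rw [contDiffOn_euclidean]
  intro i
  have hE : ContDiff ℝ n (evalElem L p i) := contDiff_evalElem L p i hnp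
  have h1 : ContDiffOn ℝ n (fun z : ℝ × ℝ³ => ⟪levRead p (G z.1), evalElem L p i z.2⟫_ℝ) (Icc 0 T ×ˢ univ) :=
    (hF.comp contDiff_fst.contDiffOn fun z hz => hz.1).inner ℝ (hE.comp_contDiffOn contDiff_snd.contDiffOn)
  refine h1.congr ?_
  rintro ⟨t, x⟩ ⟨ht, -⟩
  exact hW.pathVel_apply hs1 (by omega) (by omega) ht x i

/-- The slices of the velocity are `C^n` on `ℝ³` for `2n + 4 ≤ p < s`. [folklore] -/
theorem IsWindowed.contDiff_pathVel_slice {n p : ℕ} (hnp : 2 * n + 4 ≤ p) (hps : p < s) {t : ℝ} (ht : t ∈ Icc 0 T) :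
    ContDiff ℝ n (pathVel L G t) := by
  have hs1 : 1 ≤ s := by omega
  rw [contDiff_euclidean]
  intro i
  have hE : ContDiff ℝ n (evalElem L p i) := contDiff_evalElem L p i hnp
  have h1 : ContDiff ℝ n (fun x : ℝ³ => ⟪levRead p (G t), evalElem L p i x⟫_ℝ) := contDiff_const.inner ℝ hE
  have he : (fun x => pathVel L G t x i) = fun x : ℝ³ => ⟪levRead p (G t), evalElem L p i x⟫_ℝ :=
    funext fun x => hW.pathVel_apply hs1 (by omega) hps.le ht x i
  rw [he]; exact h1

/-- **The time derivative of the velocity**: within `[0, T]`,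
`∂ₜ u(t, x) = −fromTorus L (physVel (pathAcc G t)) x` (`s ≥ 6`). [cite: KatoLai1984, Thm I, §5] -/
theorem IsWindowed.hasDerivWithinAt_pathVel (hs : 6 ≤ s) {t : ℝ} (ht : t ∈ Icc 0 T) (x : ℝ³) :
    HasDerivWithinAt (fun τ => pathVel L G τ x) (-fromTorus L (physVel (pathAcc hL G t)) x) (Icc 0 T) t := by
  have hs1 : 1 ≤ s := by omega
  have hd := hW.hasDerivWithinAt_levRead (show 2 ≤ 4 by norm_num) (by omega : 4 + 1 < s) ht
  have h2 := (evalCLM L 4 x).hasFDerivAt.comp_hasDerivWithinAt t hd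
  have hval : evalCLM L 4 x (-bilExt hL (show 2 ≤ 4 by norm_num) (levRead (4 + 1) (G t)) (levRead (4 + 1) (G t))) =
      -fromTorus L (physVel (pathAcc hL G t)) x := by
    rw [map_neg, (atLevel_pathAcc hL G t).evalCLM_eq le_rfl]; rfl
  rw [hval] at h2
  refine h2.congr (fun τ hτ => ?_) ?_
  · exact hW.pathVel_eq_evalCLM hs1 le_rfl (by omega) hτ x
  · exact hW.pathVel_eq_evalCLM hs1 le_rfl (by omega) ht x

end Path

end PeriodicCylinder

end Literature.Analysis.FluidPDE
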